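import Summits.ResolutionOfSingularities.ResolutionOfSingularities.Theorems.UltraWalkPoly
import HarnessLib

/-!
# UltraWalkCert — isolation CERTIFICATES of bounded size; certified forced runs; the certified uniform bound

NODE «UltraWalk» (decomp-res lens-3, gen 30), file 3/5: the SPLIT BENEATH the translation.  The only clause of a forced
run that is not a coefficient identity of bounded complexity is `IsolatedTop q F := ∃ N g, g(0) ≠ 0 ∧ ∀ i, g·xᵢᴺ ∈ J_top`
(the exponent `N`, the multiplier `g` and the ideal-membership cofactors are unbounded).  We type

* `CertData q β F` / `IsolatedTopCert q β F` — an isolation certificate of SIZE `≤ β` (`N ≤ β`, `deg g ≤ β`, cofactors of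
  degree `≤ β` against the Hasse derivatives `D^{(a)}F`, `0 < |a| < q`), `isolatedTop_of_cert` (carve);
* `CertRun β q s₀ B` — a forced run (`UniformWalks.ForcedRun`, VERBATIM, extended) whose isolation at time `i` is
  certified in size `β i`; `CertRun.restrict`; the forgetful carve is the parent projection `CertRun.toForcedRun`;
* `UnifBoundCert β d B` — the binders of `UniformWalks.UnifBound d B` VERBATIM with `CertRun β` for `ForcedRun`, and the
  carve `unifBoundCert_of_unifBound : UnifBound d B → UnifBoundCert β d B`.

No `sorry`, standard axioms. (Sources: Hauser2010, §§F–G; vandenDriesSchmidt1984, §1 (bounded ideal membership).) [folklore]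
-/

noncomputable section

open MvPolynomial
open Literature.AlgebraicGeometry.Resolution
open Literature.AlgebraicGeometry.Resolution.Hauser2010
open Literature.AlgebraicGeometry.Resolution.PointBlowup
open Summit.ResolutionOfSingularities.ResolutionOfSingularities.Theorems.TightDefectClasses
open Summit.ResolutionOfSingularities.ResolutionOfSingularities.Theorems.UniformWalks (ForcedRun UnifBound)

namespace Summit.ResolutionOfSingularities.ResolutionOfSingularities.Theorems.UltraWalk

/-! ## §1 Certificates of bounded size for `IsolatedTop` -/

/-- The finite INDEX SET of the Hasse derivatives generating the top ideal: `0 < |a| < q`. DEFINITION (support). [folklore] -/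
def hasseIndex (σ : Type) [DecidableEq σ] [Fintype σ] (q : ℕ) : Finset (σ →₀ ℕ) :=
  (dbox σ q).filter fun a => a ≠ 0 ∧ a.degree < q

/-- Membership in the index set. [folklore] -/
theorem mem_hasseIndex {σ : Type} [DecidableEq σ] [Fintype σ] {q : ℕ} {a : σ →₀ ℕ} :
    a ∈ hasseIndex σ q ↔ a ≠ 0 ∧ a.degree < q := by
  rw [hasseIndex, Finset.mem_filter]
  exact ⟨fun h => h.2, fun h => ⟨mem_dbox_iff.mpr h.2.le, h⟩⟩

section Cert

variable {σ : Type} [DecidableEq σ] [Fintype σ] {K : Type} [CommRing K]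

/-- **An ISOLATION CERTIFICATE of size `≤ β`** for `IsolatedTop q F`: an exponent `N ≤ β`, a multiplier `g` of degree
`≤ β` with `g(0) ≠ 0`, and for each variable `x_l` cofactors `h l a` of degree `≤ β` with
`g · x_lᴺ = Σ_{0<|a|<q} h l a · D^{(a)} F`.  NEW TYPED OBJECT (support). [folklore] -/
structure CertData (q β : ℕ) (F : MvPolynomial σ K) where
  /-- the exponent -/
  N : ℕ
  /-- … bounded by the size -/
  N_le : N ≤ β
  /-- the multiplier, a unit at the origin -/
  g : MvPolynomial σ K
  /-- … of bounded degree -/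
  g_deg : g.totalDegree ≤ β
  /-- … not vanishing at the origin -/
  g_zero : coeff 0 g ≠ 0
  /-- the ideal-membership cofactors -/
  h : σ → (σ →₀ ℕ) → MvPolynomial σ K
  /-- … of bounded degree -/
  h_deg : ∀ l a, (h l a).totalDegree ≤ β
  /-- the membership identities -/
  eq : ∀ l : σ, g * X l ^ N = ∑ a ∈ hasseIndex σ q, h l a * hasseDeriv K a F

/-- `IsolatedTopCert q β F`: an isolation certificate of size `≤ β` EXISTS. NEW CLASS (support). [folklore] -/
def IsolatedTopCert (q β : ℕ) (F : MvPolynomial σ K) : Prop := Nonempty (CertData q β F)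

/-- Monotonicity of certificates in the size. [folklore] -/
def CertData.mono {q β β' : ℕ} {F : MvPolynomial σ K} (c : CertData q β F) (h : β ≤ β') : CertData q β' F where
  N := c.N
  N_le := c.N_le.trans h
  g := c.g
  g_deg := c.g_deg.trans h
  g_zero := c.g_zero
  h := c.h
  h_deg l a := (c.h_deg l a).trans h
  eq := c.eq

/-- Monotonicity of `IsolatedTopCert` in the size. [folklore] -/
theorem isolatedTopCert_mono {q β β' : ℕ} {F : MvPolynomial σ K} (h : β ≤ β') (hc : IsolatedTopCert q β F) :
    IsolatedTopCert q β' F := by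
  obtain ⟨c⟩ := hc
  exact ⟨c.mono h⟩

end Cert

/-- **CARVE: a certified isolated top IS an isolated top** (the certificate's identities are memberships in `topIdeal`).
[folklore] -/
theorem isolatedTop_of_cert {σ : Type} [DecidableEq σ] [Fintype σ] {K : Type} [Field K] {q β : ℕ} {F : MvPolynomial σ K}
    (hc : IsolatedTopCert q β F) : IsolatedTop q F := by
  obtain ⟨c⟩ := hc
  refine ⟨c.N, c.g, ?_, fun l => ?_⟩
  · rw [MvPolynomial.constantCoeff_eq]; exact c.g_zero
  · rw [c.eq l]
    refine Ideal.sum_mem _ fun a ha => Ideal.mul_mem_left _ _ (Ideal.subset_span ⟨a, ?_, rfl⟩)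
    exact (mem_hasseIndex.mp ha)

/-! ## §2 Certified forced runs and the certified uniform bound -/

section Runs

variable {K : Type} [Field K] [DecidableEq K]

/-- **A CERTIFIED forced run**: a forced run of the model (`UniformWalks.ForcedRun`, VERBATIM, extended) whose isolation
at time `i < B` carries a certificate of size `≤ β i`.  NEW TYPED OBJECT (support). [folklore] -/
structure CertRun (β : ℕ → ℕ) (q : ℕ) (s₀ : State (Fin 3) K) (B : ℕ) extends ForcedRun q s₀ B where
  /-- the isolation certificates along the run -/
  cert : ∀ i, i < B → IsolatedTopCert q (β i) (st i).F

/-- Restriction of a certified run to a shorter length. [folklore] -/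
def CertRun.restrict {β : ℕ → ℕ} {q : ℕ} {s₀ : State (Fin 3) K} {B : ℕ} (R : CertRun β q s₀ B) {B' : ℕ} (h : B' ≤ B) :
    CertRun β q s₀ B' where
  toForcedRun := R.toForcedRun.restrict h
  cert i hi := R.cert i (lt_of_lt_of_le hi h)

/-- The states of a restricted run are the original ones. [folklore] -/
@[simp] theorem CertRun.restrict_st {β : ℕ → ℕ} {q : ℕ} {s₀ : State (Fin 3) K} {B : ℕ} (R : CertRun β q s₀ B)
    {B' : ℕ} (h : B' ≤ B) (i : ℕ) : (R.restrict h).st i = R.st i := rfl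

end Runs

/-- **`UnifBoundCert β d B` — the CERTIFIED UNIFORM BOUND**: over every perfect field of every characteristic, NO
`β`-certified forced run of length `B + 1` starts at a root of degree `≤ d`.  The binders are those of
`UniformWalks.UnifBound d B` VERBATIM; only `ForcedRun` is replaced by `CertRun β`.  [WEAKER than `UnifBound d B` by
letter (`unifBoundCert_of_unifBound`) · DECIDED for every `β, d` by the Łoś transfer (`UltraWalkLaw.unifBoundCert_exists`)
· EXACT mod the located residual `BoundedIsolation`] (Sources: Marker2002, Ex. 2.5.19; vandenDriesSchmidt1984, §1.) -/
def UnifBoundCert (β : ℕ → ℕ) (d B : ℕ) : Prop :=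
  ∀ p : ℕ, p.Prime → ∀ e : ℕ, 1 ≤ e → ∀ (K : Type) [Field K] [CharP K p] [PerfectField K] [DecidableEq K]
    (s₀ : State (Fin 3) K), IsRoot (p ^ e) s₀ → s₀.F.totalDegree ≤ d → CertRun β (p ^ e) s₀ (B + 1) → False

/-- **CARVE**: the uniform bound implies the certified uniform bound (forget the certificates). [folklore] -/
theorem unifBoundCert_of_unifBound {β : ℕ → ℕ} {d B : ℕ} (h : UnifBound d B) : UnifBoundCert β d B :=
  fun p hp e he K _ _ _ _ s₀ hr hd R => h p hp e he K s₀ hr hd R.toForcedRun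

/-- Monotonicity of the certified bound in the length. [folklore] -/
theorem unifBoundCert_mono {β : ℕ → ℕ} {d B B' : ℕ} (hB : B ≤ B') (h : UnifBoundCert β d B) : UnifBoundCert β d B' :=
  fun p hp e he K _ _ _ _ s₀ hr hd R => h p hp e he K s₀ hr hd (R.restrict (Nat.succ_le_succ hB))

end Summit.ResolutionOfSingularities.ResolutionOfSingularities.Theorems.UltraWalk
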